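import Literature.Computability.Cryptography.InaccessibleEntropyUOWHFTree
import Literature.Computability.Cryptography.HashAndSignOTSFromUOWHF
import Literature.Computability.Cryptography.SchemesCommitment
import HarnessLib

/-!
# One-way functions give secure one-time signature schemes (Goldreich 2004, Thm. 6.4.29 with Thm. 6.4.32)

Topic `Literature/Computability/Cryptography`. The junction of two proved lines of the tree:

* `HHRVW.exists_isUOWHF_of_OWFExist` (`InaccessibleEntropyUOWHFTree.lean`): one-way functions ⇒ universal
  one-way hash functions — Goldreich 2004, Thm. 6.4.29 (Rompel 1990), proved along Haitner–Holenstein–Reingold–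
  Vadhan–Wee 2020, Thm. 5.1 (inaccessible entropy) and Goldreich's §6.4.3 Steps II–IV (composition and tree
  hashing), in the existence form with a polynomial index-coin budget and indices of one polynomial length;
* `exists_isOneTimeSecure_of_OWFExist_of_exists_isUOWHF` (`HashAndSignOTSFromUOWHF.lean`): one-way functions and
  such a UOWHF ⇒ secure one-time signature schemes — Goldreich 2004, Thm. 6.4.32 (one-time hash-and-sign,
  Construction 6.4.30 / Prop. 6.4.31, over the Lamport-type length-restricted scheme, Construction 6.4.4 /
  Cor. 6.4.6).

Hence **`exists_isOneTimeSecure_of_OWFExist`**: the hypothesis `h₁` of the tree's printed assembly of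
Goldreich's Thm. 6.4.1 (`secureSignaturesExist_of_OWFExist_of_oneTimeSecure`, `SchemesProofs.lean`) is a
theorem; and, through Impagliazzo–Luby (`OWFExist_of_bitCommitmentExist_holds`), bit commitment gives secure
one-time signature schemes (`exists_isOneTimeSecure_of_bitCommitmentExist`). What remains of Thm. 6.4.1 / of
`secureSignaturesExist_of_bitCommitmentExist` is Thm. 6.4.9 (one-time ⇒ general signatures by authentication
trees, `TreeSig*.lean`). All proved; no named facts.

## References

* O. Goldreich, *Foundations of Cryptography II: Basic Applications*, CUP 2004, Thm. 6.4.1, Thm. 6.4.29,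
  Thm. 6.4.32, §6.4.3.4 ("Combining Theorems 6.4.29, 6.4.32, and 6.4.9, we establish Theorem 6.4.1").
* J. Rompel, *One-way functions are necessary and sufficient for secure signatures*, STOC 1990, Thm. 1, Thm. 3.
* I. Haitner, T. Holenstein, O. Reingold, S. Vadhan, H. Wee, *Inaccessible entropy II: IE functions and
  universal one-way hashing*, Theory of Computing 16 (2020), Thm. 5.1.
* R. Impagliazzo, M. Luby, *One-way functions are essential for complexity based cryptography*, FOCS 1989.
-/

namespace Literature.Computability.Cryptography

/-- **One-way functions ⇒ secure one-time signature schemes** (Goldreich 2004, Thm. 6.4.29 + Thm. 6.4.32;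
Rompel 1990): the UOWHF of `HHRVW.exists_isUOWHF_of_OWFExist` fed to the one-time hash-and-sign construction.
[cite: Goldreich2004, Thm. 6.4.32 with Thm. 6.4.29; Rompel1990, Thm. 1] -/
theorem exists_isOneTimeSecure_of_OWFExist (h : OWFExist) : ∃ S : SignatureScheme, S.IsOneTimeSecure :=
  exists_isOneTimeSecure_of_OWFExist_of_exists_isUOWHF h (HHRVW.exists_isUOWHF_of_OWFExist h)

/-- **Bit commitment ⇒ secure one-time signature schemes** (through one-way functions, Impagliazzo–Luby 1989).
[cite: Goldreich2004, Thm. 6.4.32 with Thm. 6.4.29; ImpagliazzoLuby1989, §3] -/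
theorem exists_isOneTimeSecure_of_bitCommitmentExist (h : BitCommitmentExist) :
    ∃ S : SignatureScheme, S.IsOneTimeSecure :=
  exists_isOneTimeSecure_of_OWFExist (OWFExist_of_bitCommitmentExist_holds h)

/-- **Thm. 6.4.1 / `secureSignaturesExist_of_OWFExist` reduced to Thm. 6.4.9 alone**: given the step "secure
one-time signature schemes ⇒ secure (memoryless) signature schemes", one-way functions give EUF-CMA signatures.
[cite: Goldreich2004, Thm. 6.4.1 and §6.4.3.4] -/
theorem secureSignaturesExist_of_OWFExist_of_thm649
    (h₂ : (∃ S : SignatureScheme, S.IsOneTimeSecure) → SecureSignaturesExist) : secureSignaturesExist_of_OWFExist :=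
  secureSignaturesExist_of_OWFExist_of_oneTimeSecure exists_isOneTimeSecure_of_OWFExist h₂

/-- The same for bit commitment (Impagliazzo–Luby 1989 composed with the above).
[cite: ImpagliazzoLuby1989, §3; Goldreich2004, Thm. 6.4.1] -/
theorem secureSignaturesExist_of_bitCommitmentExist_of_thm649
    (h₂ : (∃ S : SignatureScheme, S.IsOneTimeSecure) → SecureSignaturesExist) :
    secureSignaturesExist_of_bitCommitmentExist :=
  secureSignaturesExist_of_bitCommitmentExist_of_oneTimeSecure exists_isOneTimeSecure_of_OWFExist h₂

end Literature.Computability.Cryptography
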